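import Mathlib
import Summits.ValiantsHypothesis.ValiantsHypothesis.Theorems.TwoProducts.Negative.RankTwoEscapes
import Summits.ValiantsHypothesis.ValiantsHypothesis.Theorems.TwoProducts.Negative.CommonPadding
import Summits.ValiantsHypothesis.ValiantsHypothesis.Theorems.TwoProducts.Negative.RankTwoPaddingClassCover
import HarnessLib

/-!
# NEGATIVE lane (val-neg-1 g5): block-merge kit for the COMMON DEEP PADDING

Helper file for crux `stmt-ValiantsHypothesis-5906` (filed `--supports`; closes NO item, proves NO summit statement, does NOT prove
`TwoProducts`, `PlanarCellBound` or VP ≠ VNP; 0 `def`s).  Elementary facts about the tokens `tuples`, `blockSet`, `mergeA`, `BlockSmall`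
(`PlanarCell`) and `msetT`, `PermType` (`PermutationType`) used by `Negative/RankTwoPaddingBlockMerge.lean`:
permutation type is invariant under reindexing (`permType_comp_perm`, `permType_mergeA_comm`) and non-permutation-type lifts along a
positionwise inclusion with zero padding (`not_permType_lift`); block sums of padded tuples (`blockSum_append`, `blockSet_subset_padding`,
`mergeA_subset_padding`); old block sums are shallow (`deg_blockSet_le`); a gadget position outside the block keeps a planted pair alive
(`not_permType_mergeA_of_gadget_outside`); singleton blocks are lattice-small (`blockSmall_singleton`, `mergeA_singleton_subset`).  [folklore]
-/

namespace Summit.ValiantsHypothesis.Theorems.TwoProducts.Negative.RankTwoPaddingMergeKit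


open Finset MvPolynomial
open Summit.ValiantsHypothesis.ValiantsHypothesis.Theorems.NewtonUnitEquations.TwoProducts.FormalLogLinearisation
open Summit.ValiantsHypothesis.ValiantsHypothesis.Theorems.NewtonUnitEquations.TwoProducts.PlanarCell
open Summit.ValiantsHypothesis.ValiantsHypothesis.Theorems.NewtonUnitEquations.TwoProducts.PermutationType
  (msetT PermType RankOneCoincidences)
open Summit.ValiantsHypothesis.Theorems.TwoProducts.Negative.CommonPadding
open Summit.ValiantsHypothesis.Theorems.TwoProducts.Negative.RankTwoPaddingClassCover (append_zero_mem_tuples sum_append_zero)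

variable {m k : ℕ}

/-! ### Permutation type: reindexing and zero padding -/

/-- `msetT` of an appended tuple. [folklore] -/
theorem msetT_append (x : Fin m → Expo) (z : Fin k → Expo) : msetT (Fin.append x z) = msetT x + msetT z := by
  unfold msetT
  rw [Fin.sum_univ_add]
  simp only [Fin.append_left, Fin.append_right]

/-- `msetT 0 = 0`. [folklore] -/
theorem msetT_zero_fun : msetT (0 : Fin k → Expo) = 0 := by
  simp [msetT]

/-- Permutation type is stable under reindexing the positions by a permutation. [folklore] -/
theorem permType_comp_perm {M : Fin m → Finset Expo} (h : PermType M) (σ : Equiv.Perm (Fin m)) : PermType (M ∘ σ) := by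
  intro a ha b hb hs
  have lift : ∀ c : Fin m → Expo, c ∈ tuples (M ∘ σ) → c ∘ σ.symm ∈ tuples M := by
    intro c hc
    rw [tuples, Fintype.mem_piFinset] at hc ⊢
    intro j
    simpa using hc (σ.symm j)
  have hsum : ∀ c : Fin m → Expo, ∑ j, (c ∘ σ.symm) j = ∑ j, c j := fun c => Equiv.sum_comp σ.symm c
  have hms : ∀ c : Fin m → Expo, msetT (c ∘ σ.symm) = msetT c := fun c =>
    Equiv.sum_comp σ.symm (fun i => if c i = 0 then (0 : Expo →₀ ℕ) else Finsupp.single (c i) 1)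
  have := h _ (lift a ha) _ (lift b hb) (by rw [hsum, hsum, hs])
  rwa [hms, hms] at this

/-- Moving the block position inside `J` is a transposition of positions. [folklore] -/
theorem mergeA_comm_eq (A : Fin m → Finset Expo) (J : Finset (Fin m)) {j₀ j₁ : Fin m} (hj₀ : j₀ ∈ J) (hj₁ : j₁ ∈ J) :
    mergeA A J j₁ = mergeA A J j₀ ∘ Equiv.swap j₀ j₁ := by
  classical
  funext j
  simp only [Function.comp_apply, mergeA]
  by_cases h1 : j = j₁
  · subst h1; simp
  by_cases h0 : j = j₀
  · subst h0
    rw [Equiv.swap_apply_left]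
    simp [h1, hj₀, hj₁, Ne.symm h1]
  · rw [Equiv.swap_apply_of_ne_of_ne h0 h1]
    simp [h0, h1]

/-- Permutation type of a block merge does not depend on which position of the block carries the block. [folklore] -/
theorem permType_mergeA_comm (A : Fin m → Finset Expo) (J : Finset (Fin m)) {j₀ j₁ : Fin m} (hj₀ : j₀ ∈ J) (hj₁ : j₁ ∈ J)
    (h : PermType (mergeA A J j₀)) : PermType (mergeA A J j₁) := by
  rw [mergeA_comm_eq A J hj₀ hj₁]; exact permType_comp_perm h _

/-- Zero padding of a letter tuple along a positionwise inclusion. [folklore] -/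
theorem append_zero_mem_tuples_of_subset {B : Fin m → Finset Expo} {B' : Fin (m + 4) → Finset Expo}
    (hB : ∀ j, B j ⊆ B' (Fin.castAdd 4 j)) {x : Fin m → Expo} (hx : x ∈ tuples B) :
    Fin.append x (0 : Fin 4 → Expo) ∈ tuples B' := by
  rw [tuples, Fintype.mem_piFinset] at hx ⊢
  intro j
  refine Fin.addCases (fun j => ?_) (fun i => ?_) j
  · simp only [Fin.append_left]; exact Finset.insert_subset_insert _ (hB j) (hx j)
  · simp only [Fin.append_right, Pi.zero_apply, Finset.mem_insert, true_or]

/-- **Non-permutation type lifts along zero padding.** [folklore] -/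
theorem not_permType_lift {B : Fin m → Finset Expo} {B' : Fin (m + 4) → Finset Expo}
    (hB : ∀ j, B j ⊆ B' (Fin.castAdd 4 j)) (h : ¬ PermType B) : ¬ PermType B' := by
  intro h'
  apply h
  intro x hx y hy hs
  have := h' _ (append_zero_mem_tuples_of_subset hB hx) _ (append_zero_mem_tuples_of_subset hB hy)
    (by rw [sum_append_zero, sum_append_zero, hs])
  rwa [msetT_append, msetT_append, msetT_zero_fun, add_zero, add_zero] at this

/-! ### Block sums of padded tuples -/

/-- Block sum of a padded tuple over a block `J'`: old part over `{j | castAdd j ∈ J'}` plus gadget part. [folklore] -/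
theorem blockSum_append (a : Fin m → Expo) (g : Fin 4 → Expo) (J' : Finset (Fin (m + 4))) :
    ∑ j ∈ J', Fin.append a g j =
      ∑ j ∈ Finset.univ.filter (fun j : Fin m => Fin.castAdd 4 j ∈ J'), a j +
        ∑ i ∈ Finset.univ.filter (fun i : Fin 4 => Fin.natAdd m i ∈ J'), g i := by
  classical
  have h1 : ∑ j ∈ J', Fin.append a g j = ∑ j, if j ∈ J' then Fin.append a g j else 0 := by
    rw [← Finset.sum_filter]; simp
  rw [h1, Fin.sum_univ_add, Finset.sum_filter, Finset.sum_filter]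
  simp only [Fin.append_left, Fin.append_right]

/-- The old block set embeds in the padded block set (gadget coordinates `0`). [folklore] -/
theorem blockSet_subset_padding (u v : Fin m → MvPolynomial (Fin 2) ℂ) (w : Fin 4 → MvPolynomial (Fin 2) ℂ)
    (J' : Finset (Fin (m + 4))) :
    blockSet (fun j => (u j).support ∪ (v j).support) (Finset.univ.filter fun j : Fin m => Fin.castAdd 4 j ∈ J') ⊆
      blockSet (fun j => (Fin.append u w j).support ∪ (Fin.append v w j).support) J' := by
  classical
  intro β hβ
  rw [blockSet, Finset.mem_image] at hβ ⊢
  obtain ⟨a, ha, rfl⟩ := hβ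
  refine ⟨Fin.append a 0, append_zero_mem_tuples u v w ha, ?_⟩
  rw [blockSum_append]; simp

/-- The merged OLD family embeds positionwise in the merged PADDED family (block carried by the same old position). [folklore] -/
theorem mergeA_subset_padding (u v : Fin m → MvPolynomial (Fin 2) ℂ) (w : Fin 4 → MvPolynomial (Fin 2) ℂ)
    (J' : Finset (Fin (m + 4))) (j₁ : Fin m) (j : Fin m) :
    mergeA (fun j => (u j).support ∪ (v j).support) (Finset.univ.filter fun j : Fin m => Fin.castAdd 4 j ∈ J') j₁ j ⊆
      mergeA (fun j => (Fin.append u w j).support ∪ (Fin.append v w j).support) J' (Fin.castAdd 4 j₁) (Fin.castAdd 4 j) := by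
  classical
  have hinj : ∀ {a b : Fin m}, (Fin.castAdd 4 a : Fin (m + 4)) = Fin.castAdd 4 b ↔ a = b := fun {a b} =>
    ⟨fun h => Fin.castAdd_injective _ _ h, fun h => h ▸ rfl⟩
  simp only [mergeA, hinj, Finset.mem_filter, Finset.mem_univ, true_and]
  by_cases h1 : j = j₁
  · simp only [h1, if_true]
    exact Finset.erase_subset_erase _ (blockSet_subset_padding u v w J')
  · simp only [h1, if_false]
    by_cases h2 : (Fin.castAdd 4 j : Fin (m + 4)) ∈ J'
    · simp [h2]
    · simp [h2, Fin.append_left]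

/-! ### Degrees: old block sums are shallow, gadget letters are deep -/

/-- A tail letter is coordinatewise below the tail sum. [folklore] -/
theorem le_tailSum {u v : Fin m → MvPolynomial (Fin 2) ℂ} {e : Expo} (he : e ∈ tailSupport u v) :
    e ≤ ∑ f ∈ tailSupport u v, f :=
  Finset.single_le_sum (f := fun f => f) (fun _ _ => zero_le) he

/-- Old block sums have degree `≤ m · deg s`. [folklore] -/
theorem deg_blockSet_le (u v : Fin m → MvPolynomial (Fin 2) ℂ) (J : Finset (Fin m)) {β : Expo}
    (hβ : β ∈ blockSet (fun j => (u j).support ∪ (v j).support) J) :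
    β 0 + β 1 ≤ m * ((∑ f ∈ tailSupport u v, f) 0 + (∑ f ∈ tailSupport u v, f) 1) := by
  classical
  rw [blockSet, Finset.mem_image] at hβ
  obtain ⟨a, ha, rfl⟩ := hβ
  rw [tuples, Fintype.mem_piFinset] at ha
  have hle : ∀ j, a j 0 + a j 1 ≤ (∑ f ∈ tailSupport u v, f) 0 + (∑ f ∈ tailSupport u v, f) 1 := by
    intro j
    rcases Finset.mem_insert.1 (ha j) with h | h
    · rw [h]; simp
    · have hT : a j ∈ tailSupport u v := by
        unfold tailSupport
        rcases Finset.mem_union.1 h with h | h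
        · exact Finset.mem_union_left _ (Finset.mem_biUnion.2 ⟨j, Finset.mem_univ _, h⟩)
        · exact Finset.mem_union_right _ (Finset.mem_biUnion.2 ⟨j, Finset.mem_univ _, h⟩)
      have := le_tailSum hT
      exact add_le_add (this 0) (this 1)
  calc (∑ j ∈ J, a j) 0 + (∑ j ∈ J, a j) 1 = ∑ j ∈ J, (a j 0 + a j 1) := by
        rw [Finsupp.finsetSum_apply, Finsupp.finsetSum_apply, ← Finset.sum_add_distrib]
    _ ≤ ∑ j ∈ J, ((∑ f ∈ tailSupport u v, f) 0 + (∑ f ∈ tailSupport u v, f) 1) := Finset.sum_le_sum fun j _ => hle j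
    _ = J.card * _ := by rw [Finset.sum_const, smul_eq_mul]
    _ ≤ m * _ := Nat.mul_le_mul_right _ (by simpa using Finset.card_le_univ J)

/-! ### Evaluating `mergeA`; single-position tuples -/

/-- The block position of `mergeA` carries the non-zero block sums. [folklore] -/
theorem mergeA_apply_self (M : Fin k → Finset Expo) (J : Finset (Fin k)) (j₀ : Fin k) :
    mergeA M J j₀ j₀ = (blockSet M J).erase 0 := by
  simp [mergeA]

/-- Off the block, `mergeA` is the original family. [folklore] -/
theorem mergeA_apply_of_not_mem (M : Fin k → Finset Expo) (J : Finset (Fin k)) {j₀ j : Fin k} (hj₀ : j₀ ∈ J) (hj : j ∉ J) :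
    mergeA M J j₀ j = M j := by
  have : j ≠ j₀ := fun h => hj (h ▸ hj₀)
  simp [mergeA, this, hj]

/-- A tuple supported on one position. [folklore] -/
theorem single_mem_tuples {M : Fin k → Finset Expo} {q : Fin k} {x : Expo} (hx : x ∈ insert 0 (M q)) :
    (Pi.single q x : Fin k → Expo) ∈ tuples M := by
  classical
  rw [tuples, Fintype.mem_piFinset]
  intro j
  by_cases h : j = q
  · subst h; simpa using hx
  · simp [h]

/-- A letter at a block position is a block sum. [folklore] -/
theorem mem_blockSet_of_mem {M : Fin k → Finset Expo} {J : Finset (Fin k)} {q : Fin k} (hq : q ∈ J) {x : Expo} (hx : x ∈ M q) :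
    x ∈ blockSet M J := by
  classical
  rw [blockSet, Finset.mem_image]
  refine ⟨Pi.single q x, single_mem_tuples (Finset.mem_insert_of_mem hx), ?_⟩
  rw [Finset.sum_pi_single', if_pos hq]

/-- **A gadget position outside the block keeps a planted pair alive in the merged family.**  Positions `p ∉ J` and `q ≠ p` both
carrying the letters `n s, 2n s` (`s ≠ 0`, `n ≠ 0`): the merged family is not of permutation type. [folklore] -/
theorem not_permType_mergeA_of_gadget_outside (M : Fin k → Finset Expo) (J : Finset (Fin k)) {j₀ p q : Fin k} (hj₀ : j₀ ∈ J)
    (hp : p ∉ J) (hqp : q ≠ p) {s : Expo} (hs : s ≠ 0) {n : ℕ} (hn : n ≠ 0) (hp1 : n • s ∈ M p)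
    (hq1 : n • s ∈ M q) (hq2 : (2 * n) • s ∈ M q) : ¬ PermType (mergeA M J j₀) := by
  classical
  have hMp : mergeA M J j₀ p = M p := mergeA_apply_of_not_mem M J hj₀ hp
  by_cases hq : q ∈ J
  · have hj₀p : j₀ ≠ p := fun h => hp (h ▸ hj₀)
    have hB1 : n • s ∈ mergeA M J j₀ j₀ := by
      rw [mergeA_apply_self]
      exact Finset.mem_erase.2 ⟨nsmul_ne_zero' hs hn, mem_blockSet_of_mem hq hq1⟩
    have hB2 : (2 * n) • s ∈ mergeA M J j₀ j₀ := by
      rw [mergeA_apply_self]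
      exact Finset.mem_erase.2 ⟨nsmul_ne_zero' hs (by omega), mem_blockSet_of_mem hq hq2⟩
    obtain ⟨ha, hb, hsum, -, -, hne⟩ := planted_pair (A := mergeA M J j₀) hj₀p hs hn hB1 hB2 (by rw [hMp]; exact hp1)
    exact fun hP => hne (hP _ ha _ hb hsum)
  · have hMq : mergeA M J j₀ q = M q := mergeA_apply_of_not_mem M J hj₀ hq
    obtain ⟨ha, hb, hsum, -, -, hne⟩ := planted_pair (A := mergeA M J j₀) hqp hs hn (by rw [hMq]; exact hq1)
      (by rw [hMq]; exact hq2) (by rw [hMp]; exact hp1)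
    exact fun hP => hne (hP _ ha _ hb hsum)

/-! ### Singleton blocks are lattice-small -/

/-- A singleton block of a `t`-sparse instance is lattice-small at the threshold `2^m (t+2)^4`. [folklore] -/
theorem blockSmall_singleton {t : ℕ} (u v : Fin m → MvPolynomial (Fin 2) ℂ) (hu : ∀ j, coeff 0 (u j) = 0 ∧ (u j).support.card ≤ t)
    (hv : ∀ j, coeff 0 (v j) = 0 ∧ (v j).support.card ≤ t) (j : Fin m) :
    BlockSmall (fun j => (u j).support ∪ (v j).support) {j} (2 ^ m * (t + 2) ^ 4) := by
  classical
  refine ⟨insert 0 ((u j).support ∪ (v j).support), ?_, fun a ha => ?_⟩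
  · have h1 : (insert 0 ((u j).support ∪ (v j).support)).card ≤ 2 * t + 1 := by
      calc _ ≤ ((u j).support ∪ (v j).support).card + 1 := Finset.card_insert_le _ _
        _ ≤ (u j).support.card + (v j).support.card + 1 := Nat.add_le_add_right (Finset.card_union_le _ _) _
        _ ≤ 2 * t + 1 := by have := (hu j).2; have := (hv j).2; omega
    have h2 : 2 * t + 1 ≤ (t + 2) ^ 4 := by
      calc 2 * t + 1 ≤ (t + 2) ^ 2 := by nlinarith
        _ ≤ (t + 2) ^ 4 := Nat.pow_le_pow_right (by omega) (by omega)
    have h3 : (t + 2) ^ 4 ≤ 2 ^ m * (t + 2) ^ 4 := Nat.le_mul_of_pos_left _ (Nat.two_pow_pos m)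
    omega
  · rw [tuples, Fintype.mem_piFinset] at ha
    simpa using ha j

/-- The merged family of a singleton block sits positionwise inside the original family (`0` is not a letter). [folklore] -/
theorem mergeA_singleton_subset (u v : Fin m → MvPolynomial (Fin 2) ℂ) (j i : Fin m) :
    mergeA (fun j => (u j).support ∪ (v j).support) {j} j i ⊆ (u i).support ∪ (v i).support := by
  classical
  by_cases h : i = j
  · subst h
    rw [mergeA_apply_self]
    intro β hβ
    rw [Finset.mem_erase, blockSet, Finset.mem_image] at hβ
    obtain ⟨hβ0, a, ha, rfl⟩ := hβ
    rw [tuples, Fintype.mem_piFinset] at ha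
    have := ha i
    rw [Finset.sum_singleton] at hβ0 ⊢
    exact (Finset.mem_insert.1 this).resolve_left hβ0
  · rw [mergeA_apply_of_not_mem _ _ (Finset.mem_singleton_self j) (by simpa using h)]

end Summit.ValiantsHypothesis.Theorems.TwoProducts.Negative.RankTwoPaddingMergeKit
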